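import Summits.ValiantsHypothesis.ValiantsHypothesis.Theorems.BarrierLeverDcSliceCoversVP

/-!
# Line `dcslice` on crux `DefinableEquations` (stmt-ValiantsHypothesis-8745), route BarrierLever

The dc-slice feed: ONE proof of `DefinableDcEquations` (item 8746, any admissible threshold) closes the
rank-3 crux `DefinableEquations` verbatim, because `DcSliceCoversVP : DefinableDcEquations → DefinableEquations`
is a tree theorem (`Theorems.dcSliceCoversVP_proof`: VP ⊆ VQP-det, dc f ≤ 2^(17 b² (log₂ n+1)²) < m(n) eventually).
Registered so that 8746 is IN-CONE for `closes` (director-valiant 2026-08-26 14:16Z; planner p1-g11).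
The single stub is the whole of item 8746 — by design: this line is a FEED, not a decomposition.
-/

namespace Summit.ValiantsHypothesis.ValiantsHypothesis.Cruxes.DefinableEquations.Dcslice

open Summit.ValiantsHypothesis.ValiantsHypothesis

/-- stub = item stmt-ValiantsHypothesis-8746 verbatim (the GCT / HWV instantiation on the determinantal slice). -/
theorem stub_dcSlice : Theses.BarrierLever.DefinableDcEquations := by
  sorry

/-- composition: the crux follows from the stub by the tree theorem `dcSliceCoversVP_proof`. -/
theorem DefinableEquations_of :
    Theses.BarrierLever.DefinableDcEquations → Theses.BarrierLever.DefinableEquations :=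
  Theorems.dcSliceCoversVP_proof

end Summit.ValiantsHypothesis.ValiantsHypothesis.Cruxes.DefinableEquations.Dcslice
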